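import Summits.Ventures.LatticeQCDFlow.Scoring.WilsonFlowRK3ObservableRate
import Summits.Ventures.LatticeQCDFlow.Scoring.AlphaRoundedCharge
import HarnessLib

/-!
# The INTEGER-ROUNDED measured flowed charge equals the integer-rounded exactly flowed charge, for all sufficiently fine steps, on every configuration whose exactly flowed charge passes an integrality cut — and the disagreement probability is bounded by the cut's failure probability

HONEST FRAMING: exact (Metropolis-corrected) sampling algorithms for lattice gauge theory;
figures of merit are autocorrelation/cost numbers at stated couplings and volumes; no
continuum-physics claim.

Venture `LatticeQCDFlow` (cell pub-lqcd), sub-topic `Scoring`; FANOUT row 16 (`su2-base`: the SCORED topological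
charge is an integer, `round(α · Q)` of the flowed clover charge with a rescaling `α`; acceptance test (b) compares two
integer-rounded definitions and asks for an integrality cut `|αQ − round(αQ)| ≤ 0.1` on `≥ 90 %`).  Eighth file of
the RK3-CONVERGENCE packet: `WilsonFlowRK3ObservableRate.abs_rk3CloverCharge_sub_le_div` (the measured flowed charge
`Q_{t/m,m} = Σ_x P_x ∘ RK3_{t/m}^m` is within `C/m` of the exactly flowed `Q_t = Σ_x P_x ∘ wilsonFlow t`, uniformly)
combined with gen-3's rounding-agreement criterion `AlphaRoundedCharge.round_eq_round_of_integrality`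
(`|x − round x| ≤ δ`, `|y − x| < ½ − δ` ⇒ `round y = round x`).  NEW WORK of the cell (placement rule); nothing is
cited as a fact; no number.  Printed counterpart, NAMED ONLY: none (bookkeeping).

## What is here (`d = 4`, `SU(n)` fundamental, every `L ≥ 1`, flow time `t ≥ 0`, rescaling `α ∈ ℝ`)

* **`round_rk3CloverCharge_eq_round`** — there is `C ≥ 0` (the rate constant) such that for every `m ≥ t`, every
  integrality tolerance `δ` with `|α| C / m < ½ − δ` and EVERY configuration `V` whose exactly flowed rescaled charge
  is within `δ` of an integer, `round (α Q_{t/m,m}(V)) = round (α Q_t(V))`: refining the step cannot change the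
  scored integer except on configurations whose exact flowed charge sits (within `|α|C/m`) at a half-integer.
* **`eventually_round_rk3CloverCharge_eq_round`** — for every `δ < ½`: for all sufficiently large `m`, the two
  roundings agree simultaneously on ALL configurations passing the cut `δ`.
* **`measure_round_ne_le`** — for every measure `μ` on configurations (the Wilson measure, a chain's law at
  any step), every `δ` and every `m ≥ t` with `|α| C / m < ½ − δ`:
  `μ {V | round (α Q_{t/m,m} V) ≠ round (α Q_t V)} ≤ μ {V | δ < |α Q_t V − round (α Q_t V)|}` — the probability that
  the step size changes the scored integer is at most the probability that the exactly flowed charge FAILS the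
  integrality cut.

NOT CLAIMED: that flowed charges pass any integrality cut (an empirical rate — the row's number); anything about the
cooled charge `Q_L` (the other definition of test (b)); the constants; any number.
-/

namespace Summit.Ventures.LatticeQCDFlow.Scoring

open Matrix Filter Topology Set MeasureTheory Literature.MathematicalPhysics.QuantumFieldTheory
open Literature.MathematicalPhysics.QuantumLattice (fundamentalRep continuous_fundamentalRep cloverPseudoscalar
  continuous_cloverPseudoscalar)

open scoped Matrix.Norms.Frobenius NNReal

-- The scoped Frobenius instances are definitionally the product structures, but only at default transparency
-- (as in Mathlib's `MatrixExponential` and `Scoring/WilsonFlowRK3Consistency`).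
set_option backward.isDefEq.respectTransparency false

variable {L n : ℕ} [NeZero L]

/-- Shorthand used only in this file's statements: the total clover charge of a configuration on `(ℤ/L)^4`
(`SU(n)` fundamental), `Q(U) = Σ_x P_x(U)`; the measured flowed charge is `Q ∘ RK3_{t/m}^m`, the exactly flowed one
`Q ∘ wilsonFlow t`. -/
noncomputable def cloverChargeSum (U : GaugeConfig 4 L (Matrix.specialUnitaryGroup (Fin n) ℂ)) : ℝ :=
  ∑ x : Site 4 L, cloverPseudoscalar (fundamentalRep (Fin n)) x U

/-- Unfolding of `cloverChargeSum`. -/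
theorem cloverChargeSum_apply (U : GaugeConfig 4 L (Matrix.specialUnitaryGroup (Fin n) ℂ)) :
    cloverChargeSum U = ∑ x : Site 4 L, cloverPseudoscalar (fundamentalRep (Fin n)) x U := rfl

/-- **The scored integer is step-size independent for fine steps, off the half-integers.**  For every `t ≥ 0` and
`α` there is `C ≥ 0` such that for all `m ≥ t`, all `δ` with `|α| C / m < ½ − δ` and every configuration `V` with
`|α Q_t(V) − round(α Q_t(V))| ≤ δ`: `round (α Q_{t/m,m}(V)) = round (α Q_t(V))`. -/
theorem round_rk3CloverCharge_eq_round {t : ℝ} (ht : 0 ≤ t) (α : ℝ) :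
    ∃ C : ℝ, 0 ≤ C ∧ ∀ m : ℕ, t ≤ m → ∀ δ : ℝ, |α| * C / m < 1 / 2 - δ →
      ∀ V : GaugeConfig 4 L (Matrix.specialUnitaryGroup (Fin n) ℂ),
        |α * cloverChargeSum (wilsonFlow t V) - round (α * cloverChargeSum (wilsonFlow t V))| ≤ δ →
          round (α * cloverChargeSum ((wilsonFlowRK3 (t / m))^[m] V)) = round (α * cloverChargeSum (wilsonFlow t V)) := by
  obtain ⟨C, hC0, hC⟩ := abs_rk3CloverCharge_sub_le_div (L := L) (n := n) ht
  refine ⟨C, hC0, fun m hm δ hδ V hV => ?_⟩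
  refine round_eq_round_of_integrality hV ?_
  have hdiff : |cloverChargeSum ((wilsonFlowRK3 (t / m))^[m] V) - cloverChargeSum (wilsonFlow t V)| ≤ C / m := by
    simpa only [cloverChargeSum_apply] using hC m hm V
  calc |α * cloverChargeSum ((wilsonFlowRK3 (t / m))^[m] V) - α * cloverChargeSum (wilsonFlow t V)|
        = |α| * |cloverChargeSum ((wilsonFlowRK3 (t / m))^[m] V) - cloverChargeSum (wilsonFlow t V)| := by
          rw [← mul_sub, abs_mul]
    _ ≤ |α| * (C / m) := mul_le_mul_of_nonneg_left hdiff (abs_nonneg α)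
    _ = |α| * C / m := by ring
    _ < 1 / 2 - δ := hδ

/-- **Eventually, simultaneously for all configurations passing the cut.**  For every `t ≥ 0`, `α` and every
integrality tolerance `δ < ½`: for all sufficiently large `m`, every configuration whose exactly flowed rescaled
charge is within `δ` of an integer gets the same scored integer from the measured (RK3) and the exact flow. -/
theorem eventually_round_rk3CloverCharge_eq_round {t : ℝ} (ht : 0 ≤ t) (α : ℝ) {δ : ℝ} (hδ : δ < 1 / 2) :
    ∀ᶠ m : ℕ in atTop, ∀ V : GaugeConfig 4 L (Matrix.specialUnitaryGroup (Fin n) ℂ),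
      |α * cloverChargeSum (wilsonFlow t V) - round (α * cloverChargeSum (wilsonFlow t V))| ≤ δ →
        round (α * cloverChargeSum ((wilsonFlowRK3 (t / m))^[m] V)) = round (α * cloverChargeSum (wilsonFlow t V)) := by
  obtain ⟨C, hC0, hC⟩ := round_rk3CloverCharge_eq_round (L := L) (n := n) ht α
  -- `|α| C / m → 0`, so eventually `|α| C / m < ½ − δ`; and eventually `m ≥ t`
  have hlim : Tendsto (fun m : ℕ => |α| * C / m) atTop (𝓝 0) := tendsto_const_div_atTop_nhds_zero_nat (|α| * C)
  have hev : ∀ᶠ m : ℕ in atTop, |α| * C / m < 1 / 2 - δ := hlim (Iio_mem_nhds (by linarith))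
  have hmt : ∀ᶠ m : ℕ in atTop, t ≤ (m : ℝ) := tendsto_natCast_atTop_atTop.eventually_ge_atTop t
  filter_upwards [hev, hmt] with m hm1 hm2 V hV
  exact hC m hm2 δ hm1 V hV

/-- The total clover charge is a continuous observable. -/
theorem continuous_cloverChargeSum : Continuous (cloverChargeSum (L := L) (n := n)) :=
  continuous_finsetSum _ fun x _ =>
    continuous_cloverPseudoscalar (fundamentalRep (Fin n)) (continuous_fundamentalRep (Fin n)) x

/-- The measured and the exactly flowed total charges are measurable observables. -/
theorem measurable_cloverChargeSum_comp {G : GaugeConfig 4 L (Matrix.specialUnitaryGroup (Fin n) ℂ) →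
    GaugeConfig 4 L (Matrix.specialUnitaryGroup (Fin n) ℂ)} (hG : Continuous G) :
    Measurable fun V : GaugeConfig 4 L (Matrix.specialUnitaryGroup (Fin n) ℂ) => cloverChargeSum (G V) :=
  (continuous_cloverChargeSum.comp hG).measurable

/-- **The disagreement probability is at most the integrality-cut failure probability.**  For every measure
`μ` on configurations, every `t ≥ 0`, `α`: with the constant `C` of `round_rk3CloverCharge_eq_round`, for all
`m ≥ t` and `δ` with `|α| C / m < ½ − δ`,
`μ {V | round (α Q_{t/m,m} V) ≠ round (α Q_t V)} ≤ μ {V | δ < |α Q_t V − round (α Q_t V)|}`. -/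
theorem measure_round_ne_le (μ : Measure (GaugeConfig 4 L (Matrix.specialUnitaryGroup (Fin n) ℂ)))
    {t : ℝ} (ht : 0 ≤ t) (α : ℝ) :
    ∃ C : ℝ, 0 ≤ C ∧ ∀ m : ℕ, t ≤ m → ∀ δ : ℝ, |α| * C / m < 1 / 2 - δ →
      μ {V | round (α * cloverChargeSum ((wilsonFlowRK3 (t / m))^[m] V)) ≠ round (α * cloverChargeSum (wilsonFlow t V))}
        ≤ μ {V | δ < |α * cloverChargeSum (wilsonFlow t V) - round (α * cloverChargeSum (wilsonFlow t V))|} := by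
  obtain ⟨C, hC0, hC⟩ := round_rk3CloverCharge_eq_round (L := L) (n := n) ht α
  refine ⟨C, hC0, fun m hm δ hδ => measure_mono fun V hV => ?_⟩
  -- contrapositive of the pointwise statement
  by_contra hle
  exact hV (hC m hm δ hδ V (le_of_not_gt hle))

end Summit.Ventures.LatticeQCDFlow.Scoring
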